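/-
Copyright (c) 2026 the pub-hodgecm-mathlib formalisation cell (harness21).  Prover seat hodgecm-mathlib-K2E4-p10 (g4), Track B ∕ K2-LIT, h413 =
`stmt-HodgeConjecture-24833`, line `K2_E1_TraceFormulaBeta`, campaign «EIS-RANK-ONE» rung R6h — THE CAPSTONE «(R6h-3 FINAL)» dealt by K2E1-plan (g4) 2026-09-04T06:52:22Z (2):
pole control of the intertwined coefficient of `U(2,1)` at the CM pair on the Godement half-plane, with the relation of record DERIVED from ★ «CM-FINAL» ED. 2.
-/
import Summits.HodgeConjecture.HodgeConjecture.Theorems.K2E1MaassSelbergPoleControlCMThree   -- ★ p858014 (this seat): §3 `poleControl_diag_flatSectionU_cm_three` (+ ★ R6g-b∕c, ★ R6h-a, the letter)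
import Summits.HodgeConjecture.HodgeConjecture.Theorems.K2E1MaassSelbergCMThreeFinal         -- ★ p858111 (K2E4-p14 g6): «CM-FINAL» ED. 2 `maassSelberg_flatSectionU_cm_three_final′`
import HarnessLib

/-!
# K2·E1 — `K2E1MaassSelbergPoleControlCMThreeFinal`: POLE CONTROL OF THE INTERTWINED COEFFICIENT OF `U(2,1)` OVER A CM FIELD ON `{Re z > 2, Im z ≠ 0}` — THE CAPSTONE
# (campaign «EIS-RANK-ONE», rung R6h: ★ CM-FINAL′ (relation of record per `z′`) + ★ (R6g-b∕c) (diagonal by dominated convergence) + ★ (R6h-a∕b) (junction) ⟹ IV.3.12's analytic core on the Godement half-plane)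

Track B ∕ K2-LIT, crux h413 = `stmt-HodgeConjecture-24833`, route of record `HCCMUnconditional`; cell `hodgecm-mathlib`, squad K2, ENGINE E1.  Prover seat
`hodgecm-mathlib-K2E4-p10` (g4); DEAL (2) «CAPSTONE» of the dealer K2E1-plan (g4) 2026-09-04T06:52:22Z, REPORT-FIRST 07:01Z.  THEOREMS ONLY (no `def`, no `instance`, no notation,
no named-fact hypothesis, no `sorry`); lane `--supports stmt-HodgeConjecture-24833 --as helper` (count-neutral).  Closes no socket.

THE MATHEMATICS [MoeglinWaldspurger1995, IV.2.3 and IV.3.12 (a); Arthur1980TraceFormulaII, §4; Garrett2018, §1.12 and §11.3].  For a flat section `f_z = φ·H^z` of `U(J₃)` over the CM pair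
`(L⁺, L, conj)` put `a = [Ξ₁]` (the `‖φ‖²`-bracket), `b(z) = [Ξ₄(z)]` (the `‖φ̃_z‖²`-bracket of the intertwined coefficient), `W = [Ξ₂(z)]`.  ★ «CM-FINAL» ED. 2 gives, for EVERY `z′` on
the sub-tube `2 < Re z′ < Re z`, the relation `⟨Λ^T E(f_z), Λ^T E(f_{z′})⟩_X = R(z′)` with the explicit four-term `R(z′) = c_μ·K·((T^{s₁}∕s₁)[Ξ₁] + (T^{s₂}∕s₂)[Ξ₂(z′)] − (T^{−s₂}∕s₂)[Ξ₃] −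
(T^{−s₁}∕s₁)[Ξ₄(z′)])`, `s₁ = z + conj z′ − 2`, `s₂ = z − conj z′` — the brackets `[Ξ₂(z′)]`, `[Ξ₄(z′)]` being FUNCTIONS of `z′` through the intertwined coefficient `φ̃_{z′}` (RULING «VAC-B»).
§1 `continuousWithinAt_fourTerm`: `R` is continuous at `z′ = z` from inside the sub-tube as soon as `z′ ↦ [Ξ₂(z′)]`, `[Ξ₄(z′)]` are (★ (R6j) p858065 layers) — the `T^{±s}∕s` factors are
continuous there because `s₁(z) = 2(Re z − 1) ≠ 0` and `s₂(z) = 2i·Im z ≠ 0`.  §2 **`poleControl_flatSectionU_cm_three_final`**: ★ p858014 `poleControl_diag_flatSectionU_cm_three` (whose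
`hcont`∕`hΛ′bdd` are ★ (R6g-c)∕(R6g-a)) fed with `hrel` DERIVED per `z′` from ★ CM-FINAL′, `hR` from §1, `hRz` by `rfl`, and the diagonal identification `[Ξ₁] = a > 0`, `[Ξ₃] = conj W`,
`[Ξ₄(z)] = b ≥ 0`, `‖W‖² ≤ ab` (★ p858038 currency) ⟹ **(a1)** `√b ≤ x·T^{2x}·√a∕|y| + √(x²T^{4x}a∕y² + aT^{4x})`, **(a2)** the uniform box form, **(a3)** `b ≤ C∕y²` for `|y| ≤ 1`
(`x = Re z − 1`, `y = Im z`): «no pole of `‖Λ^T E(φ,z)‖²`-growth type off the real axis on `Re z > 2`; order ≤ 1 on vertical approach» — IV.3.12's analytic CORE on the Godement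
half-plane.  NAMED SURVIVORS (honest, exactly): `hdec′` pointwise on the sub-tube + `hdecU` locally uniform at `z` (the decay of `E(f) − E(f)_B` on `{H > T}`, [D2]∕(D2-e)∕(D2-f)∕[D5]₃
chain), the `K_U`-average data `Ξ₁, Ξ₂(·), Ξ₃, Ξ₄(·)` with their torus identities (★ p857588 dichotomy, the consumer's datum), the bracket continuity `hB₂ hB₄` and the diagonal
identification `h₁ h₃ h₄ hW` (bracket-level; ★ p858065 ∕ ★ p858038 pay them once the `Ξᵢ^{(z′)}` are chosen concretely).  CEILING NOT CLAIMED: R7 (crossing `Re z = 2 → 1`) and R8.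
HONEST LABEL: HC_CM is proved only modulo the 7 printed citations (2 remaining named inputs: hLiu418 = `stmt-HodgeConjecture-24832`, h413 = `stmt-HodgeConjecture-24833`) until rung 0
closes; this file asserts no named fact and closes no socket.
References: [MoeglinWaldspurger1995] IV.2.3, IV.3.12 · [Arthur1980TraceFormulaII] §4 · [Garrett2018] §1.12, §11.3.
-/

set_option autoImplicit false
-- the mandated namespace repeats the single-problem summit's segment (`HodgeConjecture.HodgeConjecture`)
set_option linter.dupNamespace false

noncomputable section

open MeasureTheory Measure NumberField IsDedekindDomain Set Filter Topology MulAction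
open scoped ENNReal NNReal ComplexConjugate
open Literature.MeasureTheory.Group Literature.NumberTheory
open Literature.NumberTheory.Automorphic Literature.NumberTheory.Automorphic.UnitaryGroup AdelicGroupData
open Summit.HodgeConjecture.HodgeConjecture.Cruxes.H413.K2E1BorelEisensteinU
open Summit.HodgeConjecture.HodgeConjecture.Cruxes.H413.K2E1MaassSelbergPoleControlCMThree
open Summit.HodgeConjecture.HodgeConjecture.Cruxes.H413.K2E1MaassSelbergCMThreeFinal (maassSelberg_flatSectionU_cm_three_final')
open Summit.HodgeConjecture.HodgeConjecture.Cruxes.H413.K2E1BorelCosetsDictionary (forall_arithmeticBorel_iff)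

namespace Summit.HodgeConjecture.HodgeConjecture.Cruxes.H413.K2E1MaassSelbergPoleControlCMThreeFinal

/-! ## §1 The explicit right side is continuous at `z′ = z` when the two moving brackets are -/

/-- **THE FOUR-TERM RIGHT SIDE WITH BRACKET FUNCTIONS IS CONTINUOUS AT `z′ = z`** (within any `S`): constants `B₁, B₃`, functions `B₂, B₄` continuous within `S` at `z`, real `T > 0`,
and the base-point non-vanishings `z + conj z − 2 ≠ 0` (`Re z ≠ 1`), `z − conj z ≠ 0` (`Im z ≠ 0`) — the factors `T^{±s}∕s` are continuous in `z′` (`conj` continuous, `w ↦ T^w` entire, division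
away from `0`).  RULING «VAC-B», functions edition. [cite: MoeglinWaldspurger1995, IV.2.3] [cite: Arthur1980TraceFormulaII, §4] -/
theorem continuousWithinAt_fourTerm {T : ℝ} (hT : 0 < T) {z : ℂ} (hs₁ : z + conj z - 2 ≠ 0) (hs₂ : z - conj z ≠ 0) {S : Set ℂ} {cμ K B₁ B₃ : ℂ} {B₂ B₄ : ℂ → ℂ}
    (hB₂ : ContinuousWithinAt B₂ S z) (hB₄ : ContinuousWithinAt B₄ S z) :
    ContinuousWithinAt (fun z' : ℂ => cμ * (K *
      (((T : ℂ) ^ (z + conj z' - 2) / (z + conj z' - 2)) * B₁ + ((T : ℂ) ^ (z - conj z') / (z - conj z')) * B₂ z'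
        - ((T : ℂ) ^ (-(z - conj z')) / (z - conj z')) * B₃ - ((T : ℂ) ^ (-(z + conj z' - 2)) / (z + conj z' - 2)) * B₄ z'))) S z := by
  have hTne : (T : ℂ) ≠ 0 := by exact_mod_cast hT.ne'
  have hconj : ContinuousWithinAt (fun z' : ℂ => conj z') S z := Complex.continuous_conj.continuousWithinAt
  have hs₁c : ContinuousWithinAt (fun z' : ℂ => z + conj z' - 2) S z := (continuousWithinAt_const.add hconj).sub continuousWithinAt_const
  have hs₂c : ContinuousWithinAt (fun z' : ℂ => z - conj z') S z := continuousWithinAt_const.sub hconj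
  have hp : ∀ {e : ℂ → ℂ}, ContinuousWithinAt e S z → ContinuousWithinAt (fun z' => (T : ℂ) ^ e z') S z := fun he => he.const_cpow (Or.inl hTne)
  have t₁ : ContinuousWithinAt (fun z' : ℂ => (T : ℂ) ^ (z + conj z' - 2) / (z + conj z' - 2)) S z := (hp hs₁c).div hs₁c hs₁
  have t₂ : ContinuousWithinAt (fun z' : ℂ => (T : ℂ) ^ (z - conj z') / (z - conj z')) S z := (hp hs₂c).div hs₂c hs₂
  have t₃ : ContinuousWithinAt (fun z' : ℂ => (T : ℂ) ^ (-(z - conj z')) / (z - conj z')) S z := (hp hs₂c.neg).div hs₂c hs₂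
  have t₄ : ContinuousWithinAt (fun z' : ℂ => (T : ℂ) ^ (-(z + conj z' - 2)) / (z + conj z' - 2)) S z := (hp hs₁c.neg).div hs₁c hs₁
  exact continuousWithinAt_const.mul (continuousWithinAt_const.mul ((((t₁.mul continuousWithinAt_const).add (t₂.mul hB₂)).sub (t₃.mul continuousWithinAt_const)).sub (t₄.mul hB₄)))

/-! ## §2 The capstone at the CM pair -/

section CM

variable (L : Type) [Field L] [NumberField L] [IsCMField L]
variable [MeasurableSpace (quasiSplit (↥(maximalRealSubfield L)) L (IsCMField.complexConj L) 3).Adelic] [BorelSpace (quasiSplit (↥(maximalRealSubfield L)) L (IsCMField.complexConj L) 3).Adelic]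
variable [MeasurableSpace (AdeleRing (𝓞 L) L)ˣ] [BorelSpace (AdeleRing (𝓞 L) L)ˣ]

/-- **POLE CONTROL OF THE INTERTWINED COEFFICIENT OF `U(2,1)` OVER A CM FIELD ON THE GODEMENT HALF-PLANE — THE CAPSTONE.**  For a continuous bounded left-`N(𝔸)`∕`B(L⁺)`-invariant
coefficient `φ`, `Re z > 2`, `Im z ≠ 0`, `T ≥ 1`, the structural data of ★ CM-FINAL′, the decay `hdec′` (pointwise on the sub-tube) and `hdecU` (locally uniform at `z`), the `K_U`-average data
(`Ξ₁, Ξ₃` constant; `Ξ₂(·), Ξ₄(·)` functions of `z′`), the bracket continuity `hB₂ hB₄` and the diagonal identification `[Ξ₁] = a > 0`, `[Ξ₃] = conj [Ξ₂(z)]`, `[Ξ₄(z)] = b ≥ 0`,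
`‖[Ξ₂(z)]‖² ≤ ab`: **(a1) ∧ (a2) ∧ (a3)** for `b` — `√b ≤ x·T^{2x}·√a∕|y| + √(x²T^{4x}a∕y² + aT^{4x})`, its uniform box form, and `b ≤ C∕y²` for `|y| ≤ 1` (`x = Re z − 1`, `y = Im z`).
The relation of record is DERIVED inside from ★ CM-FINAL′ for every `z′` on the sub-tube; the diagonal by ★ (R6g-b∕c); the extraction by ★ (R6h-a∕b).
[cite: MoeglinWaldspurger1995, IV.2.3 and IV.3.12 (a)] [cite: Arthur1980TraceFormulaII, §4] [cite: Garrett2018, §1.12 and §11.3] -/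
theorem poleControl_flatSectionU_cm_three_final
    (μ : Measure (quasiSplit (↥(maximalRealSubfield L)) L (IsCMField.complexConj L) 3).automorphicQuotient) [(quasiSplit (↥(maximalRealSubfield L)) L (IsCMField.complexConj L) 3).IsAutomorphicMeasure μ]
    (νG : Measure (quasiSplit (↥(maximalRealSubfield L)) L (IsCMField.complexConj L) 3).Adelic) [νG.IsHaarMeasure] [νG.IsInvInvariant]
    (μK : Measure ((standardMaximalCompactGL 3 L).comap (adelicVal (↥(maximalRealSubfield L)) L (IsCMField.complexConj L) 3 ((StdForm.antidiagonal 3).over L)) : Subgroup (quasiSplit (↥(maximalRealSubfield L)) L (IsCMField.complexConj L) 3).Adelic))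
    [μK.IsHaarMeasure]
    (νI : Measure (AdeleRing (𝓞 L) L)ˣ) [νI.IsHaarMeasure]
    {𝓕I : Set (AdeleRing (𝓞 L) L)ˣ} (h𝓕I : IsIdeleClassDomain L 𝓕I)
    (ν : Measure ↥(adelicUnipotent (↥(maximalRealSubfield L)) L (IsCMField.complexConj L) 3)) [ν.IsHaarMeasure] [ν.IsInvInvariant]
    {𝓕 : Set ↥(adelicUnipotent (↥(maximalRealSubfield L)) L (IsCMField.complexConj L) 3)} (h𝓕N : IsFundamentalDomain ↥(rationalUnipotent (↥(maximalRealSubfield L)) L (IsCMField.complexConj L) 3) 𝓕 ν) (h𝓕1 : ν 𝓕 = 1) (h𝓕c : IsCompact (closure 𝓕))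
    {β : (quasiSplit (↥(maximalRealSubfield L)) L (IsCMField.complexConj L) 3).Adelic → ℝ≥0∞} (hβ : IsCoveringWeight ((arithmeticBorel (↥(maximalRealSubfield L)) L (IsCMField.complexConj L) 3).map (quasiSplit (↥(maximalRealSubfield L)) L (IsCMField.complexConj L) 3).arithmeticSubgroup.subtype) β)
    {T : ℝ≥0} (hT : 1 ≤ T)
    {φ : (quasiSplit (↥(maximalRealSubfield L)) L (IsCMField.complexConj L) 3).Adelic → ℂ} (hφc : Continuous φ)
    (hφN : ∀ (n : unipotentInBorel (↥(maximalRealSubfield L)) L (IsCMField.complexConj L) 3) (y : (quasiSplit (↥(maximalRealSubfield L)) L (IsCMField.complexConj L) 3).Adelic), φ (((n : borelAdelic (↥(maximalRealSubfield L)) L (IsCMField.complexConj L) 3) : (quasiSplit (↥(maximalRealSubfield L)) L (IsCMField.complexConj L) 3).Adelic) * y) = φ y)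
    (hφB : ∀ b ∈ arithmeticBorel (↥(maximalRealSubfield L)) L (IsCMField.complexConj L) 3, ∀ y : (quasiSplit (↥(maximalRealSubfield L)) L (IsCMField.complexConj L) 3).Adelic, φ ((b : (quasiSplit (↥(maximalRealSubfield L)) L (IsCMField.complexConj L) 3).Adelic) * y) = φ y)
    {Cφ : ℝ} (hφC : ∀ x, ‖φ x‖ ≤ Cφ)
    {z : ℂ} (hz : 2 < z.re) (hy : z.im ≠ 0)
    -- NAMED: the decay of `E(f_{z′}) − E(f_{z′})_B` on `{H > T}` — pointwise on the sub-tube ([D2] chain) and locally uniformly at `z` ((R6g-a) input)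
    (hdec' : ∀ z' : ℂ, 2 < z'.re → z'.re < z.re → ∃ M₁' : ℝ, ∀ g : (quasiSplit (↥(maximalRealSubfield L)) L (IsCMField.complexConj L) 3).Adelic, T < borelHeight g →
      ‖eisensteinSeriesU (flatSectionU φ z') g - borelConstantTerm ν 𝓕 (eisensteinSeriesU (flatSectionU φ z')) g‖ ≤ M₁')
    {V : Set ℂ} (hV : V ∈ 𝓝 z) {M₁ : ℝ}
    (hdecU : ∀ z' ∈ V, ∀ g : (quasiSplit (↥(maximalRealSubfield L)) L (IsCMField.complexConj L) 3).Adelic, T < borelHeight g → ‖eisensteinSeriesU (flatSectionU φ z') g - borelConstantTerm ν 𝓕 (eisensteinSeriesU (flatSectionU φ z')) g‖ ≤ M₁)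
    -- the `K_U`-average data: CONSTANT `Ξ₁` (`φ·conj φ`), `Ξ₃` (`φ̃_z·conj φ`); FAMILIES `Ξ₂ z′` (`φ·conj φ̃_{z′}`), `Ξ₄ z′` (`φ̃_z·conj φ̃_{z′}`) («VAC-B»: functions of `z′`)
    {Ξ₁ Ξ₃ : (AdeleRing (𝓞 L) L)ˣ → ℂ} {Ξ₂ Ξ₄ : ℂ → (AdeleRing (𝓞 L) L)ˣ → ℂ}
    (hΞ₁m : Measurable Ξ₁) {CΞ₁ : ℝ} (hΞ₁C : ∀ x, ‖Ξ₁ x‖ ≤ CΞ₁) (hΞ₁K : ∀ k ∈ GaloisRepresentations.principalIdeles L, ∀ x, Ξ₁ (k * x) = Ξ₁ x)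
    (hΞ₁M : ∀ (r : ℝ≥0ˣ) (x : (AdeleRing (𝓞 L) L)ˣ), Ξ₁ (posRealIdele L r * x) = Ξ₁ x)
    (hΞ₁ : ∀ t : torusInBorel (↥(maximalRealSubfield L)) L (IsCMField.complexConj L) 3, ∫ k, φ (((t : borelAdelic (↥(maximalRealSubfield L)) L (IsCMField.complexConj L) 3) : (quasiSplit (↥(maximalRealSubfield L)) L (IsCMField.complexConj L) 3).Adelic) * (k : (quasiSplit (↥(maximalRealSubfield L)) L (IsCMField.complexConj L) 3).Adelic)) * conj (φ (((t : borelAdelic (↥(maximalRealSubfield L)) L (IsCMField.complexConj L) 3) : (quasiSplit (↥(maximalRealSubfield L)) L (IsCMField.complexConj L) 3).Adelic) * (k : (quasiSplit (↥(maximalRealSubfield L)) L (IsCMField.complexConj L) 3).Adelic))) ∂μK = Ξ₁ (diagUnit (t : borelAdelic (↥(maximalRealSubfield L)) L (IsCMField.complexConj L) 3).2 0))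
    (hΞ₂m : ∀ z' : ℂ, Measurable (Ξ₂ z')) {CΞ₂ : ℂ → ℝ} (hΞ₂C : ∀ (z' : ℂ) x, ‖Ξ₂ z' x‖ ≤ CΞ₂ z') (hΞ₂K : ∀ z' : ℂ, ∀ k ∈ GaloisRepresentations.principalIdeles L, ∀ x, Ξ₂ z' (k * x) = Ξ₂ z' x)
    (hΞ₂M : ∀ (z' : ℂ) (r : ℝ≥0ˣ) (x : (AdeleRing (𝓞 L) L)ˣ), Ξ₂ z' (posRealIdele L r * x) = Ξ₂ z' x)
    (hΞ₂ : ∀ (z' : ℂ) (t : torusInBorel (↥(maximalRealSubfield L)) L (IsCMField.complexConj L) 3), ∫ k, φ (((t : borelAdelic (↥(maximalRealSubfield L)) L (IsCMField.complexConj L) 3) : (quasiSplit (↥(maximalRealSubfield L)) L (IsCMField.complexConj L) 3).Adelic) * (k : (quasiSplit (↥(maximalRealSubfield L)) L (IsCMField.complexConj L) 3).Adelic)) * conj ((fun g : (quasiSplit (↥(maximalRealSubfield L)) L (IsCMField.complexConj L) 3).Adelic => (∫ v : ↥(adelicUnipotent (↥(maximalRealSubfield L)) L (IsCMField.complexConj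 L) 3), flatSectionU φ z' ((quasiSplit (↥(maximalRealSubfield L)) L (IsCMField.complexConj L) 3).toAdelic (weylLongU ((IsCMField.complexConj L : L ≃ₐ[↥(maximalRealSubfield L)] L) : L →+* L) (rfl : (StdForm.antidiagonal 3).over L = (StdForm.antidiagonal 3).over L)) * ((v : (quasiSplit (↥(maximalRealSubfield L)) L (IsCMField.complexConj L) 3).Adelic) * g)) ∂ν) * ((borelHeight g : ℝ) : ℂ) ^ (z' - 2)) (((t : borelAdelic (↥(maximalRealSubfield L)) L (IsCMField.complexConj L) 3) : (quasiSplit (↥(maximalRealSubfield L)) L (IsCMField.complexConj L) 3).Adelic) * (k : (quasiSplit (↥(maximalRealSubfield L)) L (IsCMField.complexConj L) 3).Adelic))) ∂μK = Ξ₂ z' (diagUnit (t : borelAdelic (↥(maximalRealSubfield L)) L (IsCMField.complexConj L) 3).2 0))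
    (hΞ₃m : Measurable Ξ₃) {CΞ₃ : ℝ} (hΞ₃C : ∀ x, ‖Ξ₃ x‖ ≤ CΞ₃) (hΞ₃K : ∀ k ∈ GaloisRepresentations.principalIdeles L, ∀ x, Ξ₃ (k * x) = Ξ₃ x)
    (hΞ₃M : ∀ (r : ℝ≥0ˣ) (x : (AdeleRing (𝓞 L) L)ˣ), Ξ₃ (posRealIdele L r * x) = Ξ₃ x)
    (hΞ₃ : ∀ t : torusInBorel (↥(maximalRealSubfield L)) L (IsCMField.complexConj L) 3, ∫ k, (fun g : (quasiSplit (↥(maximalRealSubfield L)) L (IsCMField.complexConj L) 3).Adelic => (∫ v : ↥(adelicUnipotent (↥(maximalRealSubfield L)) L (IsCMField.complexConj L) 3), flatSectionU φ z ((quasiSplit (↥(maximalRealSubfield L)) L (IsCMField.complexConj L) 3).toAdelic (weylLongU ((IsCMField.complexConj L : L ≃ₐ[↥(maximalRealSubfield L)] L) : L →+* L) (rfl : (StdForm.antidiagonal 3).over L = (StdForm.antidiagonal 3).over L)) * ((v : (quasiSplit (↥(maximalRealSubfield L)) L (IsCMField.complexConj L) 3).Adelic) * g)) ∂ν) * ((borelHeight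 g : ℝ) : ℂ) ^ (z - 2)) (((t : borelAdelic (↥(maximalRealSubfield L)) L (IsCMField.complexConj L) 3) : (quasiSplit (↥(maximalRealSubfield L)) L (IsCMField.complexConj L) 3).Adelic) * (k : (quasiSplit (↥(maximalRealSubfield L)) L (IsCMField.complexConj L) 3).Adelic)) * conj (φ (((t : borelAdelic (↥(maximalRealSubfield L)) L (IsCMField.complexConj L) 3) : (quasiSplit (↥(maximalRealSubfield L)) L (IsCMField.complexConj L) 3).Adelic) * (k : (quasiSplit (↥(maximalRealSubfield L)) L (IsCMField.complexConj L) 3).Adelic))) ∂μK = Ξ₃ (diagUnit (t : borelAdelic (↥(maximalRealSubfield L)) L (IsCMField.complexConj L) 3).2 0))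
    (hΞ₄m : ∀ z' : ℂ, Measurable (Ξ₄ z')) {CΞ₄ : ℂ → ℝ} (hΞ₄C : ∀ (z' : ℂ) x, ‖Ξ₄ z' x‖ ≤ CΞ₄ z') (hΞ₄K : ∀ z' : ℂ, ∀ k ∈ GaloisRepresentations.principalIdeles L, ∀ x, Ξ₄ z' (k * x) = Ξ₄ z' x)
    (hΞ₄M : ∀ (z' : ℂ) (r : ℝ≥0ˣ) (x : (AdeleRing (𝓞 L) L)ˣ), Ξ₄ z' (posRealIdele L r * x) = Ξ₄ z' x)
    (hΞ₄ : ∀ (z' : ℂ) (t : torusInBorel (↥(maximalRealSubfield L)) L (IsCMField.complexConj L) 3), ∫ k, (fun g : (quasiSplit (↥(maximalRealSubfield L)) L (IsCMField.complexConj L) 3).Adelic => (∫ v : ↥(adelicUnipotent (↥(maximalRealSubfield L)) L (IsCMField.complexConj L) 3), flatSectionU φ z ((quasiSplit (↥(maximalRealSubfield L)) L (IsCMField.complexConj L) 3).toAdelic (weylLongU ((IsCMField.complexConj L : L ≃ₐ[↥(maximalRealSubfield L)] L) : L →+* L) (rfl : (StdForm.antidiagonal 3).over L = (StdForm.antidiagonal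 3).over L)) * ((v : (quasiSplit (↥(maximalRealSubfield L)) L (IsCMField.complexConj L) 3).Adelic) * g)) ∂ν) * ((borelHeight g : ℝ) : ℂ) ^ (z - 2)) (((t : borelAdelic (↥(maximalRealSubfield L)) L (IsCMField.complexConj L) 3) : (quasiSplit (↥(maximalRealSubfield L)) L (IsCMField.complexConj L) 3).Adelic) * (k : (quasiSplit (↥(maximalRealSubfield L)) L (IsCMField.complexConj L) 3).Adelic)) * conj ((fun g : (quasiSplit (↥(maximalRealSubfield L)) L (IsCMField.complexConj L) 3).Adelic => (∫ v : ↥(adelicUnipotent (↥(maximalRealSubfield L)) L (IsCMField.complexConj L) 3), flatSectionU φ z' ((quasiSplit (↥(maximalRealSubfield L)) L (IsCMField.complexConj L) 3).toAdelic (weylLongU ((IsCMField.complexConj L : L ≃ₐ[↥(maximalRealSubfield L)] L) : L →+* L) (rfl : (StdForm.antidiagonal 3).over L = (StdForm.antidiagonal 3).over L)) * ((v : (quasiSplit (↥(maximalRealSubfield L)) L (IsCMField.complexConj L) 3).Adelic) * g)) ∂ν) * ((borelHeight g : ℝ) : ℂ) ^ (z' - 2)) (((t : borelAdelic (↥(maximalRealSubfield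 L)) L (IsCMField.complexConj L) 3) : (quasiSplit (↥(maximalRealSubfield L)) L (IsCMField.complexConj L) 3).Adelic) * (k : (quasiSplit (↥(maximalRealSubfield L)) L (IsCMField.complexConj L) 3).Adelic))) ∂μK = Ξ₄ z' (diagUnit (t : borelAdelic (↥(maximalRealSubfield L)) L (IsCMField.complexConj L) 3).2 0))
    -- bracket continuity at `z` from inside the sub-tube ((R6j) layers ★ p858065 pay it once the `Ξᵢ^{(z′)}` are concrete) and the diagonal identification (★ p858038 Cauchy–Schwarz)
    (hB₂ : ContinuousWithinAt (fun z' : ℂ => (∫ x in {x : (AdeleRing (𝓞 L) L)ˣ | (IdeleClassGroup.ideleNorm L x : ℝ) ≤ 1} ∩ 𝓕I, ((IdeleClassGroup.ideleNorm L x : ℝ) : ℂ) * (Ξ₂ z') x ∂νI)) {z' : ℂ | 2 < z'.re ∧ z'.re < z.re} z)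
    (hB₄ : ContinuousWithinAt (fun z' : ℂ => (∫ x in {x : (AdeleRing (𝓞 L) L)ˣ | (IdeleClassGroup.ideleNorm L x : ℝ) ≤ 1} ∩ 𝓕I, ((IdeleClassGroup.ideleNorm L x : ℝ) : ℂ) * (Ξ₄ z') x ∂νI)) {z' : ℂ | 2 < z'.re ∧ z'.re < z.re} z)
    {a b : ℝ} (ha : 0 < a) (hb : 0 ≤ b) (h₁ : (∫ x in {x : (AdeleRing (𝓞 L) L)ˣ | (IdeleClassGroup.ideleNorm L x : ℝ) ≤ 1} ∩ 𝓕I, ((IdeleClassGroup.ideleNorm L x : ℝ) : ℂ) * Ξ₁ x ∂νI) = (a : ℂ)) (h₃ : (∫ x in {x : (AdeleRing (𝓞 L) L)ˣ | (IdeleClassGroup.ideleNorm L x : ℝ) ≤ 1} ∩ 𝓕I, ((IdeleClassGroup.ideleNorm L x : ℝ) : ℂ) * Ξ₃ x ∂νI) = conj (∫ x in {x : (AdeleRing (𝓞 L) L)ˣ | (IdeleClassGroup.ideleNorm L x : ℝ) ≤ 1} ∩ 𝓕I, ((IdeleClassGroup.ideleNorm L x : ℝ) : ℂ) * (Ξ₂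 z) x ∂νI))
    (h₄ : (∫ x in {x : (AdeleRing (𝓞 L) L)ˣ | (IdeleClassGroup.ideleNorm L x : ℝ) ≤ 1} ∩ 𝓕I, ((IdeleClassGroup.ideleNorm L x : ℝ) : ℂ) * (Ξ₄ z) x ∂νI) = (b : ℂ)) (hW : ‖(∫ x in {x : (AdeleRing (𝓞 L) L)ˣ | (IdeleClassGroup.ideleNorm L x : ℝ) ≤ 1} ∩ 𝓕I, ((IdeleClassGroup.ideleNorm L x : ℝ) : ℂ) * (Ξ₂ z) x ∂νI)‖ ^ 2 ≤ a * b) :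
    Real.sqrt b ≤ (z.re - 1) * (T : ℝ) ^ (2 * (z.re - 1)) * Real.sqrt a / |z.im| +
        Real.sqrt ((z.re - 1) ^ 2 * (T : ℝ) ^ (4 * (z.re - 1)) * a / z.im ^ 2 + a * (T : ℝ) ^ (4 * (z.re - 1))) ∧
      (∀ {x₁ x₂ η : ℝ}, 0 < x₁ → z.re - 1 ∈ Set.Icc x₁ x₂ → 0 < η → η ≤ |z.im| →
        b ≤ (x₂ * (T : ℝ) ^ (2 * x₂) * Real.sqrt a / η + Real.sqrt (x₂ ^ 2 * (T : ℝ) ^ (4 * x₂) * a / η ^ 2 + a * (T : ℝ) ^ (4 * x₂))) ^ 2) ∧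
      (|z.im| ≤ 1 → b ≤ ((z.re - 1) * (T : ℝ) ^ (2 * (z.re - 1)) * Real.sqrt a +
        Real.sqrt ((z.re - 1) ^ 2 * (T : ℝ) ^ (4 * (z.re - 1)) * a + a * (T : ℝ) ^ (4 * (z.re - 1)))) ^ 2 / z.im ^ 2) := by
  haveI := t2Space_adeleRing_of_numberField L
  obtain ⟨cμ, K, hcμ, hK, hfin'⟩ := maassSelberg_flatSectionU_cm_three_final' L μ νG μK νI h𝓕I ν h𝓕N h𝓕1 h𝓕c
  have hT0 : (0 : ℝ) < (T : ℝ) := lt_of_lt_of_le one_pos (by exact_mod_cast hT)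
  -- the right-hand side of record as a FUNCTION of `z′`
  set R : ℂ → ℂ := fun z' => (cμ : ℂ) * ((K : ℂ) *
    ((((T : ℝ) : ℂ) ^ (z + conj z' - 2) / (z + conj z' - 2)) * (∫ x in {x : (AdeleRing (𝓞 L) L)ˣ | (IdeleClassGroup.ideleNorm L x : ℝ) ≤ 1} ∩ 𝓕I, ((IdeleClassGroup.ideleNorm L x : ℝ) : ℂ) * Ξ₁ x ∂νI)
      + (((T : ℝ) : ℂ) ^ (z - conj z') / (z - conj z')) * (∫ x in {x : (AdeleRing (𝓞 L) L)ˣ | (IdeleClassGroup.ideleNorm L x : ℝ) ≤ 1} ∩ 𝓕I, ((IdeleClassGroup.ideleNorm L x : ℝ) : ℂ) * (Ξ₂ z') x ∂νI)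
      - (((T : ℝ) : ℂ) ^ (-(z - conj z')) / (z - conj z')) * (∫ x in {x : (AdeleRing (𝓞 L) L)ˣ | (IdeleClassGroup.ideleNorm L x : ℝ) ≤ 1} ∩ 𝓕I, ((IdeleClassGroup.ideleNorm L x : ℝ) : ℂ) * Ξ₃ x ∂νI)
      - (((T : ℝ) : ℂ) ^ (-(z + conj z' - 2)) / (z + conj z' - 2)) * (∫ x in {x : (AdeleRing (𝓞 L) L)ˣ | (IdeleClassGroup.ideleNorm L x : ℝ) ≤ 1} ∩ 𝓕I, ((IdeleClassGroup.ideleNorm L x : ℝ) : ℂ) * (Ξ₄ z') x ∂νI))) with hRdef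
  -- `hrel` DERIVED per `z′` from ★ CM-FINAL′ (`φ′ := φ`)
  have hrel : ∀ z' : ℂ, 2 < z'.re → z'.re < z.re →
      ∫ x, (quasiSplit (↥(maximalRealSubfield L)) L (IsCMField.complexConj L) 3).quotFun (truncation ν 𝓕 T (eisensteinSeriesU (flatSectionU φ z))) x * conj ((quasiSplit (↥(maximalRealSubfield L)) L (IsCMField.complexConj L) 3).quotFun (truncation ν 𝓕 T (eisensteinSeriesU (flatSectionU φ z'))) x) ∂μ = R z' := by
    intro z' hz' hzz'
    obtain ⟨M₁', hd⟩ := hdec' z' hz' hzz'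
    rw [hRdef]
    exact hfin' hβ hT hφc hφN hφB hφC hφc hφN hφB hφC hz' hzz' hd hΞ₁m hΞ₁C hΞ₁K hΞ₁M hΞ₁ (hΞ₂m z') (hΞ₂C z') (hΞ₂K z') (hΞ₂M z') (hΞ₂ z')
      hΞ₃m hΞ₃C hΞ₃K hΞ₃M hΞ₃ (hΞ₄m z') (hΞ₄C z') (hΞ₄K z') (hΞ₄M z') (hΞ₄ z')
  -- `hR`: the right side is continuous at `z` from inside the sub-tube (§1 + `hB₂`, `hB₄`)
  have hs₁ : z + conj z - 2 ≠ 0 := by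
    have hx : (0 : ℝ) < 2 * (z.re - 1) := by linarith
    rw [add_conj_sub_two_eq]; exact_mod_cast hx.ne'
  have hs₂ : z - conj z ≠ 0 := by
    rw [Complex.sub_conj]; exact mul_ne_zero (by exact_mod_cast (show (2 * z.im : ℝ) ≠ 0 from mul_ne_zero two_ne_zero hy)) Complex.I_ne_zero
  have hR : ContinuousWithinAt R {z' : ℂ | 2 < z'.re ∧ z'.re < z.re} z := by
    rw [hRdef]; exact continuousWithinAt_fourTerm hT0 hs₁ hs₂ hB₂ hB₄
  have hRz : R z = (cμ : ℂ) * ((K : ℂ) *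
    ((((T : ℝ) : ℂ) ^ (z + conj z - 2) / (z + conj z - 2)) * (∫ x in {x : (AdeleRing (𝓞 L) L)ˣ | (IdeleClassGroup.ideleNorm L x : ℝ) ≤ 1} ∩ 𝓕I, ((IdeleClassGroup.ideleNorm L x : ℝ) : ℂ) * Ξ₁ x ∂νI)
      + (((T : ℝ) : ℂ) ^ (z - conj z) / (z - conj z)) * (∫ x in {x : (AdeleRing (𝓞 L) L)ˣ | (IdeleClassGroup.ideleNorm L x : ℝ) ≤ 1} ∩ 𝓕I, ((IdeleClassGroup.ideleNorm L x : ℝ) : ℂ) * (Ξ₂ z) x ∂νI)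
      - (((T : ℝ) : ℂ) ^ (-(z - conj z)) / (z - conj z)) * (∫ x in {x : (AdeleRing (𝓞 L) L)ˣ | (IdeleClassGroup.ideleNorm L x : ℝ) ≤ 1} ∩ 𝓕I, ((IdeleClassGroup.ideleNorm L x : ℝ) : ℂ) * Ξ₃ x ∂νI)
      - (((T : ℝ) : ℂ) ^ (-(z + conj z - 2)) / (z + conj z - 2)) * (∫ x in {x : (AdeleRing (𝓞 L) L)ˣ | (IdeleClassGroup.ideleNorm L x : ℝ) ≤ 1} ∩ 𝓕I, ((IdeleClassGroup.ideleNorm L x : ℝ) : ℂ) * (Ξ₄ z) x ∂νI))) := by rw [hRdef]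
  exact poleControl_diag_flatSectionU_cm_three L ν h𝓕N (by rw [h𝓕1]; exact ENNReal.one_ne_top) hT hz hy hφc hφC (forall_arithmeticBorel_iff.1 hφB) μ hV hdecU hR hrel
    hcμ hK ha hb h₁ h₃ h₄ hW hRz

end CM

end Summit.HodgeConjecture.HodgeConjecture.Cruxes.H413.K2E1MaassSelbergPoleControlCMThreeFinal

end
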